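import Mathlib
import Summits.Ventures.PercRepro.TriangleCapStabTable
import Summits.Ventures.PercRepro.TriangleCapRowA1

/-!
# PercRepro — THE NON-BIPARTITE STABILITY TABLE ON EVERY CELL `(k, a, r)` WITH `r ≤ a + 1` OF EVERY ROW
`5 ≤ a ≤ 18` (`r = a + 1` on the rows `a ≥ 8`), `3a + 1 ≤ k`, IN ONE STATEMENT (p3, gen 47; part 200w)

`stabGapAll k a r`: `2 (k − 2a − 1)(a − r)` (the family `B2`) for `r ≤ a − 3`; `2 (k − 2a − 1)` for `r = a − 2` (the
one-triangle family `T`) and `r = a − 1` (`B2`); `2 (k − a − 3)` for `r = a` (the broom of the other bipartition);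
`2k − 10` for `r = a + 1` (the double broom). `stab_table_all`: every non-`a`-bipartite `K₄⁻`-free graph on `Fin k`
with `a (k − a) − r` edges has `Σ_v d(v)² + r (k − 1 − r) + stabGapAll k a r ≤ m k`, and the value is attained by a
non-`a`-bipartite graph (parts 200e, 200i, 200l, 200p, 200v). Axioms: standard.
-/

namespace PercRepro

namespace TriangleCap

namespace C047

open Finset

/-- The non-bipartite gap of the stability table on the cells `r ≤ a + 1`. -/
def stabGapAll (k a r : ℕ) : ℕ :=
  if r + 3 ≤ a then 2 * (k - 2 * a - 1) * (a - r)
  else if r + 1 ≤ a then 2 * (k - 2 * a - 1)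
  else if r = a then 2 * (k - a - 3)
  else 2 * k - 10

/-- **THE NON-BIPARTITE STABILITY TABLE ON EVERY CELL `r ≤ a + 1` OF EVERY ROW `5 ≤ a ≤ 18`** (`r = a + 1` for
`a ≥ 8`), `3a + 1 ≤ k`: every non-`a`-bipartite `K₄⁻`-free graph on `Fin k` with `a (k − a) − r` edges has
`Σ_v d(v)² + r (k − 1 − r) + stabGapAll k a r ≤ m k`, and the value is attained by a non-`a`-bipartite graph. -/
theorem stab_table_all (k a r : ℕ) (ha5 : 5 ≤ a) (ha18 : a ≤ 18) (hr : r ≤ a + 1) (h8 : r = a + 1 → 8 ≤ a)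
    (hk : 3 * a + 1 ≤ k) :
    (∀ (D : SimpleGraph (Fin k)) [DecidableRel D.Adj], K4mFree D → D.edgeFinset.card + r = a * (k - a) →
        (¬ ∃ A : Finset (Fin k), A.card = a ∧ BipSub D A) →
        ∑ v, deg D v * deg D v + r * (k - 1 - r) + stabGapAll k a r ≤ D.edgeFinset.card * k) ∧
      ∃ (D : SimpleGraph (Fin k)) (_ : DecidableRel D.Adj), K4mFree D ∧ D.edgeFinset.card + r = a * (k - a) ∧
        (¬ ∃ A : Finset (Fin k), A.card = a ∧ BipSub D A) ∧
        ∑ v, deg D v * deg D v + r * (k - 1 - r) + stabGapAll k a r = D.edgeFinset.card * k := by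
  rcases Nat.lt_or_ge r a with hra | hra
  · -- `r ≤ a − 1`: part 200j
    have hgap : stabGapAll k a r = stabGap k a r := by
      unfold stabGapAll stabGap
      by_cases h3 : r + 3 ≤ a
      · simp [h3]
      · have h1 : r + 1 ≤ a := by omega
        simp [h3, h1]
    rw [hgap]
    exact stab_table k a r ha5 ha18 (by omega) (by omega) (by omega)
  · rcases Nat.lt_or_ge r (a + 1) with hra' | hra'
    · -- `r = a`: part 200p
      have hr' : r = a := by omega
      subst hr'
      have hgap : stabGapAll k r r = 2 * (k - r - 3) := by
        unfold stabGapAll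
        have h3 : ¬ (r + 3 ≤ r) := by omega
        have h1 : ¬ (r + 1 ≤ r) := by omega
        simp [h3, h1]
      rw [hgap]
      exact rowA_nonbip_second_best k r ha5 ha18 (by omega)
    · -- `r = a + 1`: part 200v
      have hr' : r = a + 1 := by omega
      subst hr'
      have hgap : stabGapAll k a (a + 1) = 2 * k - 10 := by
        unfold stabGapAll
        have h3 : ¬ (a + 1 + 3 ≤ a) := by omega
        have h1 : ¬ (a + 1 + 1 ≤ a) := by omega
        simp [h3, h1]
      rw [hgap]
      exact rowA1_nonbip_second_best k a (h8 rfl) ha18 hk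

end C047

end TriangleCap

end PercRepro
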